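/-
Copyright (c) 2026 the pub-hodgecm-mathlib formalisation cell (harness21).  Prover seat hodgecm-mathlib-F0P2-p01 (g19) on LH3-p02 (g3)'s «(h) νM» sliver
(line LH3, `stub_N9`, organ J ∕ G′-side; «any free hand» 2026-09-02T09:04Z), supports-only lane of crux H413 = stmt-HodgeConjecture-24833.
-/
import Literature.NumberTheory.Automorphic.UnitaryGroupArchTopology      -- ★ instances: `arch F E c N J` is a locally compact, second countable, T₂ topological group
import Literature.NumberTheory.Automorphic.GLnIwasawaIntegration         -- ★ `isInvInvariant_of_isMulRightInvariant` (unimodular ⇒ inversion invariant, second countable LC groups)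
import Literature.NumberTheory.Automorphic.ArchLocalRelabelTransport     -- ★ `isMulRightInvariant_map_continuousMulEquiv`
import HarnessLib

/-!
# A group isomorphic to `A × K` (`A` unimodular, `K` commutative) carries a right- and inversion-invariant Haar measure

HONEST LABEL: HC_CM is proved only modulo the 7 printed citations (2 remaining: hLiu418 = stmt-HodgeConjecture-24832, h413 = stmt-HodgeConjecture-24833) until
rung 0 closes.  Literature THEOREMS file (no `def`, no `instance`, no `sorry`), cell `pub/hodgecm-mathlib`, crux H413, line LH3 (`stub_N9`, archimedean endoscopic
transfer), organ J, G′-side: the `(νM) [νM.IsHaarMeasure] [νM.IsMulRightInvariant] [νM.IsInvInvariant]` binders of ★ p850417 ∕ ★ p850444 ∕ ★ p850673 ∕ ★ p850689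
(descended orbital integrals over the centraliser `M′ = Z(γ_S s)` of a semi-regular chart point) are DISCHARGED here from the block decomposition ★ p850446
`exists_continuousMulEquiv_centralizer_gprimeTorus_semireg` (`e_M : M′ ≃ₜ* B × K`, `K` closed and commutative) and a right-invariant Haar measure on the
rank-one block `B` (or on `U(J)` after ★ LH3-p03 (g4)'s transport).  Count-neutral; generic measure theory.

* §1 `exists_isHaarMeasure_isMulRightInvariant_isInvInvariant_of_continuousMulEquiv_prod` — GENERIC: `G ≃ₜ* A × K` as topological groups, `A` carrying a
  right-invariant Haar measure `μ₀`, `K` commutative, `A` and `K` locally compact second countable ⇒ `G` carries a Haar measure that is right-invariant AND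
  inversion-invariant.  Proof: `ν := ((μ₀.prod haar_K).map e.symm)`; `haar_K` is right-invariant because `K` is commutative; products and images under
  `≃ₜ*` of right-invariant Haar measures are right-invariant Haar measures (Mathlib `prod.instIsHaarMeasure` ∕ `prod.instIsMulRightInvariant` ∕
  `ContinuousMulEquiv.isHaarMeasure_map`, ★ `isMulRightInvariant_map_continuousMulEquiv`); a right-invariant Haar measure on a second countable locally compact
  group is inversion-invariant (★ `isInvInvariant_of_isMulRightInvariant`).
* §2 `Subgroup.exists_isHaarMeasure_isMulRightInvariant_isInvInvariant_of_continuousMulEquiv_prod` — the same for a CLOSED subgroup `Z` of a second countable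
  locally compact group and a CLOSED commutative subgroup `K ≤ Z`, in the membership spelling `∀ k₁ ∈ K, ∀ k₂ ∈ K, k₁ * k₂ = k₂ * k₁` of ★ p850446.
* §3 `UnitaryGroup.exists_isHaarMeasure_isMulRightInvariant_isInvInvariant_centralizer_arch` — §2 at a centraliser `Z(s) ≤ U(J)(E ⊗ ℝ)` (`arch F E c N J`; centralisers
  are closed, Mathlib `Set.isClosed_centralizer`): the LH3 consumer's shape `(e' : ↥Z ≃ₜ* A × ↥K) (hKc) (hKcomm) (μ₀) [μ₀.IsHaarMeasure] [μ₀.IsMulRightInvariant] :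
  ∃ νM : Measure ↥Z, νM.IsHaarMeasure ∧ νM.IsMulRightInvariant ∧ νM.IsInvInvariant`, with `A` = the rank-one block `B` of ★ p850446 or `U(J)`.

## References
* [DeitmarEchterhoff2014] A. Deitmar, S. Echterhoff, *Principles of Harmonic Analysis*, 2nd ed. (2014): §1.5 Thm. 1.5.3 (Haar measure, modular function; products),
  Prop. 1.5.5 (unimodular ⇒ `μ(A⁻¹) = μ(A)`).
* [Rogawski1990] J. D. Rogawski, *Automorphic Representations of Unitary Groups in Three Variables*, Ann. of Math. Stud. 123 (1990): §8.2 p. 122 (the centralisers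
  `M′` in the descent of orbital integrals).
-/

set_option autoImplicit false

noncomputable section

open MeasureTheory MeasureTheory.Measure Topology TopologicalSpace

namespace Literature.MeasureTheory.Group

/-! ## §1 Generic: `G ≃ₜ* A × K`, `A` unimodular, `K` commutative -/

/-- **A topological group isomorphic to `A × K` — `A` with a right-invariant Haar measure, `K` commutative — carries a right- and inversion-invariant Haar measure.**
`G`, `A`, `K` topological groups, `A` and `K` locally compact and second countable (Borel σ-algebras on `G` and `A`), `e : G ≃ₜ* A × K`, `K` commutative,
`μ₀` a Haar measure on `A` that is also right-invariant.  THEN `∃ ν : Measure G`, Haar, right-invariant and inversion-invariant — namely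
`ν = (μ₀ ⊗ haar_K).map e⁻¹`.  [cite: DeitmarEchterhoff2014, §1.5 Thm. 1.5.3, Prop. 1.5.5] -/
theorem exists_isHaarMeasure_isMulRightInvariant_isInvInvariant_of_continuousMulEquiv_prod
    {G A K : Type*}
    [Group G] [TopologicalSpace G] [IsTopologicalGroup G] [MeasurableSpace G] [BorelSpace G]
    [Group A] [TopologicalSpace A] [IsTopologicalGroup A] [LocallyCompactSpace A] [SecondCountableTopology A] [MeasurableSpace A] [BorelSpace A]
    [Group K] [TopologicalSpace K] [IsTopologicalGroup K] [LocallyCompactSpace K] [SecondCountableTopology K]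
    (e : G ≃ₜ* A × K) (hK : ∀ x y : K, x * y = y * x)
    (μ₀ : Measure A) [μ₀.IsHaarMeasure] [μ₀.IsMulRightInvariant] :
    ∃ ν : Measure G, ν.IsHaarMeasure ∧ ν.IsMulRightInvariant ∧ ν.IsInvInvariant := by
  borelize K
  -- a Haar measure on `K`; it is right-invariant because `K` is commutative
  let μK : Measure K := Measure.haar
  haveI : μK.IsMulRightInvariant := by
    refine ⟨fun k => ?_⟩
    have hfun : (fun x : K => x * k) = fun x : K => k * x := funext fun x => hK x k
    rw [hfun]
    exact map_mul_left_eq_self μK k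
  -- σ-finiteness (second countable locally compact ⇒ σ-compact)
  haveI : SigmaCompactSpace A := sigmaCompactSpace_of_locallyCompact_secondCountable
  haveI : SigmaCompactSpace K := sigmaCompactSpace_of_locallyCompact_secondCountable
  -- the product is a right-invariant Haar measure on `A × K`
  haveI : (μ₀.prod μK).IsHaarMeasure := prod.instIsHaarMeasure μ₀ μK
  haveI : (μ₀.prod μK).IsMulRightInvariant := Measure.prod.instIsMulRightInvariant
  -- `G` is locally compact and second countable (homeomorphic to `A × K`)
  haveI : LocallyCompactSpace G := e.toHomeomorph.isClosedEmbedding.locallyCompactSpace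
  haveI : SecondCountableTopology G := e.toHomeomorph.isEmbedding.secondCountableTopology
  -- transport along `e⁻¹`
  refine ⟨(μ₀.prod μK).map e.symm, ContinuousMulEquiv.isHaarMeasure_map (μ₀.prod μK) e.symm,
    Literature.NumberTheory.Automorphic.UnitaryGroup.isMulRightInvariant_map_continuousMulEquiv e.symm (μ₀.prod μK), ?_⟩
  haveI : ((μ₀.prod μK).map e.symm).IsHaarMeasure := ContinuousMulEquiv.isHaarMeasure_map (μ₀.prod μK) e.symm
  haveI : ((μ₀.prod μK).map e.symm).IsMulRightInvariant :=
    Literature.NumberTheory.Automorphic.UnitaryGroup.isMulRightInvariant_map_continuousMulEquiv e.symm (μ₀.prod μK)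
  exact Literature.NumberTheory.Automorphic.isInvInvariant_of_isMulRightInvariant _

/-! ## §2 Subgroup form: a closed subgroup `Z` with a closed commutative subgroup `K ≤ Z` -/

/-- **Subgroup form of §1.**  `G₀` a second countable locally compact group, `Z ≤ G₀` CLOSED (Borel σ-algebra on `↥Z`), `K ≤ Z` CLOSED with
`∀ k₁ ∈ K, ∀ k₂ ∈ K, k₁ * k₂ = k₂ * k₁`, `e : ↥Z ≃ₜ* A × ↥K` with `A` locally compact second countable carrying a right-invariant Haar measure `μ₀`.  THEN
`∃ ν : Measure ↥Z`, Haar, right-invariant, inversion-invariant.  [cite: DeitmarEchterhoff2014, §1.5 Thm. 1.5.3, Prop. 1.5.5] -/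
theorem _root_.Subgroup.exists_isHaarMeasure_isMulRightInvariant_isInvInvariant_of_continuousMulEquiv_prod
    {G₀ : Type*} [Group G₀] [TopologicalSpace G₀] [IsTopologicalGroup G₀] [LocallyCompactSpace G₀] [SecondCountableTopology G₀]
    (Z : Subgroup G₀) (hZ : IsClosed (Z : Set G₀)) [MeasurableSpace Z] [BorelSpace Z]
    {A : Type*} [Group A] [TopologicalSpace A] [IsTopologicalGroup A] [LocallyCompactSpace A] [SecondCountableTopology A] [MeasurableSpace A] [BorelSpace A]
    (K : Subgroup Z) (hKc : IsClosed (K : Set Z)) (hKcomm : ∀ k₁, k₁ ∈ K → ∀ k₂, k₂ ∈ K → k₁ * k₂ = k₂ * k₁)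
    (e : Z ≃ₜ* A × K) (μ₀ : Measure A) [μ₀.IsHaarMeasure] [μ₀.IsMulRightInvariant] :
    ∃ ν : Measure Z, ν.IsHaarMeasure ∧ ν.IsMulRightInvariant ∧ ν.IsInvInvariant := by
  haveI : LocallyCompactSpace Z := hZ.isClosedEmbedding_subtypeVal.locallyCompactSpace
  haveI : LocallyCompactSpace K := hKc.isClosedEmbedding_subtypeVal.locallyCompactSpace
  haveI : SecondCountableTopology Z := Topology.IsEmbedding.subtypeVal.secondCountableTopology
  haveI : SecondCountableTopology K := Topology.IsEmbedding.subtypeVal.secondCountableTopology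
  exact Literature.MeasureTheory.Group.exists_isHaarMeasure_isMulRightInvariant_isInvInvariant_of_continuousMulEquiv_prod e
    (fun x y : K => Subtype.ext (hKcomm (x : Z) x.2 (y : Z) y.2)) μ₀

end Literature.MeasureTheory.Group

namespace Literature.NumberTheory.Automorphic

namespace UnitaryGroup

/-! ## §3 At a centraliser inside `U(J)(E ⊗ ℝ)` — the LH3 organ-J shape -/

/-- **«(h) νM»: a right- and inversion-invariant Haar measure on a centraliser `Z(s) ≤ U(J)(E ⊗ ℝ)` that splits as `A × K`.**  For the archimedean points
`arch F E c N J` (a second countable locally compact group, ★ `UnitaryGroupArchTopology`), a set `s`, its centraliser `Z = Z(s)` (closed, Mathlib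
`Set.isClosed_centralizer`; Borel σ-algebra on `↥Z`), a CLOSED subgroup `K ≤ Z` with `∀ k₁ ∈ K, ∀ k₂ ∈ K, k₁ k₂ = k₂ k₁`, an isomorphism of topological groups
`e′ : ↥Z ≃ₜ* A × ↥K` onto a locally compact second countable `A` (the rank-one block `B = U(σ_{w₀} diag(α_{τ₀0}, α_{τ₀2}))(ℂ)` of ★
`exists_continuousMulEquiv_centralizer_gprimeTorus_semireg`, or `U(J)` after transport) and a right-invariant Haar measure `μ₀` on `A`:
`∃ νM : Measure ↥Z, νM.IsHaarMeasure ∧ νM.IsMulRightInvariant ∧ νM.IsInvInvariant`.  [cite: DeitmarEchterhoff2014, §1.5 Thm. 1.5.3, Prop. 1.5.5]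
[cite: Rogawski1990, §8.2 p. 122] -/
theorem exists_isHaarMeasure_isMulRightInvariant_isInvInvariant_centralizer_arch
    (F E : Type) [Field F] [Field E] [NumberField E] [Algebra F E] (c : E ≃ₐ[F] E) (N : ℕ) (J : Matrix (Fin N) (Fin N) E)
    (s : Set ↥(arch F E c N J))
    [MeasurableSpace ↥(Subgroup.centralizer s)] [BorelSpace ↥(Subgroup.centralizer s)]
    {A : Type*} [Group A] [TopologicalSpace A] [IsTopologicalGroup A] [LocallyCompactSpace A] [SecondCountableTopology A] [MeasurableSpace A] [BorelSpace A]
    (K : Subgroup ↥(Subgroup.centralizer s)) (hKc : IsClosed (K : Set ↥(Subgroup.centralizer s)))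
    (hKcomm : ∀ k₁, k₁ ∈ K → ∀ k₂, k₂ ∈ K → k₁ * k₂ = k₂ * k₁)
    (e' : ↥(Subgroup.centralizer s) ≃ₜ* A × ↥K) (μ₀ : Measure A) [μ₀.IsHaarMeasure] [μ₀.IsMulRightInvariant] :
    ∃ νM : Measure ↥(Subgroup.centralizer s), νM.IsHaarMeasure ∧ νM.IsMulRightInvariant ∧ νM.IsInvInvariant :=
  (Subgroup.centralizer s).exists_isHaarMeasure_isMulRightInvariant_isInvInvariant_of_continuousMulEquiv_prod
    (Set.isClosed_centralizer s) K hKc hKcomm e' μ₀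

end UnitaryGroup

end Literature.NumberTheory.Automorphic

end
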